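/-
Copyright (c) 2026. All rights reserved.
Released under Apache 2.0 license as described in the file LICENSE.
Authors: abc-iut cell, seat abc-iut-w5-d053 (gen 4; row «COR36-FULL-NV» — a non-vacuity witness for the
residual hypothesis of the [AbsTopIII] Cor 3.6 / Cor 3.7 model column).
-/
import Literature.AnabelianGeometry.AbsoluteAnabelian.AbsTopIII.MLFGaloisModelAffineWitness
import HarnessLib

/-!
# [AbsTopIII] Prop 3.2 (iv) at the affine witness: `Π₀ = ℚ̄_p ⋊ (ℚ̄_p^× ⋊ G_k)` is RIGID — proofs

S. Mochizuki, *Topics in absolute anabelian geometry III* [MochizukiAbsTopIII2015] (kurims manuscript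
`paper:url-5493eb38cbb7`), Def 3.1 (i) p. 66, Prop 3.2 (iv) p. 72 ("this injection is a bijection if [...]
both [pairs] are of strictly Belyi type"; "[...] are id-rigid").

PROOF-ONLY companion (seat abc-iut-w5-d053 gen 4) of `MLFGaloisModelAffineWitness.lean` (the witness object
`affineModel k = (Π₀(k) ↠ G_k ↷ ℚ̄_p)`, `Π₀(k) = AffPi k` the semilinear affine group `x ↦ a·γ(x) + b`).
The group theory that makes `Π₀` rigid, for ABSTRACT group isomorphisms (no topology is used):

* `algEquiv_eq_one_of_divisible` — a divisible element of the profinite group `G_k = Gal(ℚ̄_p/k)` is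
  trivial (restrict to a finite Galois subextension moved by it; `|Gal(E/k)|`-th powers vanish);
* `AffPi.center_eq_bot` — `Π₀(k)` is centre-free;
* `AffPi.γ_eq_one_iff_divisible` — `ker ε` IS the divisible part of `Π₀(k)` (the affine group of the
  algebraically closed characteristic-`0` field `ℚ̄_p` is divisible: explicit `n`-th roots);
* `AffPi.commutator_kerε` — the translations are `⁅ker ε, ker ε⁆` (commutator with the dilation by `2`);
* `AffPi.γ_map_eq_one_iff`, `map_translations` — hence every abstract isomorphism `φ : Π₀(k₁) ≃ Π₀(k₂)`
  respects `ker ε` and the translations; `t_map_tr_conj` — the MASTER IDENTITY `A(a·γ(b)) = a'·γ'(A b)`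
  for `A := φ|_T` in translation coordinates;
* `AffPi.exists_ringEquiv_of_mulEquiv` — **AFFINE-GROUP RIGIDITY: every abstract group isomorphism
  `Π₀(k₁) ≃ Π₀(k₂)` is geometric**: `σ := A/A(1)` is a FIELD AUTOMORPHISM of `ℚ̄_p` (additive by
  construction, multiplicative by the master identity at dilations — the classical
  `Aut(F ⋊ F^×) = Inn ⋊ Aut(F)`) which intertwines the Galois parts, `σ(γ b) = γ'(σ b)` (master identity
  at Galois lifts).

`MLFGaloisModelAffineWitnessFull.lean` turns this into `(P₀.ι ⋙ TFModel.gal p).Full` and id-rigidity for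
the NONEMPTY type `P₀ = IsAffineModel`, and instantiates the Cor 3.6 / 3.7 model column there.

HONEST FRAMING: `Π₀` is NOT of hyperbolic-orbicurve / strictly-Belyi type; a CONSISTENCY / NON-VACUITY
witness for the typed hypothesis structure of the model column, not a model of [AbsTopIII] Cor 1.10.
Refereed pre-IUT material; classical group theory of affine groups; no new `Prop` fact, no definition;
nothing here bears on [IUTchIII] Cor. 3.12; instantiated ≠ endorsed.
-/

set_option autoImplicit false

noncomputable section

namespace Literature.AnabelianGeometry.AbsoluteAnabelian.AbsTopIII

open Polynomial

variable {p : ℕ} [hp : Fact p.Prime]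

namespace TFModel

/-! ## A divisible element of `G_k = Gal(ℚ̄_p/k)` is trivial -/

/-- In the profinite group `G_k = Gal(ℚ̄_p/k)` an element admitting an `n`-th root for every `n ≥ 1` is
the identity: if `γ x ≠ x`, restrict to the finite Galois closure `E` of `k(x)`; in the finite group
`Gal(E/k)` every `|Gal(E/k)|`-th power is trivial, so `γ = δ^{|Gal(E/k)|}` fixes `x`.
[cite: MochizukiAbsTopIII2015, Definition 3.1 (i) p.66] -/
theorem algEquiv_eq_one_of_divisible (k : IntermediateField ℚ_[p] (PadicAlgCl p))
    (γ : PadicAlgCl p ≃ₐ[k] PadicAlgCl p)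
    (h : ∀ n : ℕ, 0 < n → ∃ δ : PadicAlgCl p ≃ₐ[k] PadicAlgCl p, δ ^ n = γ) : γ = 1 := by
  haveI := PadicAlgCl.isGalois (p := p)
  by_contra hne
  obtain ⟨x, hx⟩ : ∃ x : PadicAlgCl p, γ x ≠ x := by
    by_contra hall
    push Not at hall
    exact hne (AlgEquiv.ext hall)
  -- the finite Galois subextension generated by `x`
  let E : IntermediateField k (PadicAlgCl p) :=
    (FiniteGaloisIntermediateField.adjoin k ({x} : Set (PadicAlgCl p))).toIntermediateField
  have hxE : x ∈ E := FiniteGaloisIntermediateField.subset_adjoin k ({x} : Set (PadicAlgCl p)) rfl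
  obtain ⟨δ, hδ⟩ := h (Fintype.card (E ≃ₐ[k] E)) Fintype.card_pos
  have h1 : AlgEquiv.restrictNormalHom E δ ^ Fintype.card (E ≃ₐ[k] E) = 1 := pow_card_eq_one
  rw [← map_pow, hδ] at h1
  have h2 : ((AlgEquiv.restrictNormalHom E γ) ⟨x, hxE⟩ : PadicAlgCl p) = γ x :=
    AlgEquiv.restrictNormal_commutes γ E ⟨x, hxE⟩
  rw [h1] at h2
  exact hx h2.symm

namespace AffPi

variable {k : IntermediateField ℚ_[p] (PadicAlgCl p)}

/-! ## `Π₀(k)` is centre-free -/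

/-- **`Π₀(k)` is centre-free**: an element commuting with all translations has `a·γ = id` on `ℚ̄_p`,
whence `a = 1`, `γ = 1`; a translation commuting with the dilation by `2` is trivial (`char ℚ̄_p = 0`).
(Centre-freeness is what Prop 3.2 (iv)'s id-rigidity argument uses of `Π`.)
[cite: MochizukiAbsTopIII2015, Proposition 3.2 (iv) p.72] -/
theorem center_eq_bot : Subgroup.center (AffPi k) = ⊥ := by
  rw [eq_bot_iff]
  intro z hz
  rw [Subgroup.mem_center_iff] at hz
  -- commuting with translations
  have htr : ∀ b : PadicAlgCl p, (z.u : PadicAlgCl p) * z.γ b = b := fun b => by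
    have e := congrArg AffPi.t (hz (tr b))
    simp only [mul_t, tr_t, tr_u, tr_γ, Units.val_one, AlgEquiv.one_apply, one_mul] at e
    linear_combination -e
  have hu : (z.u : PadicAlgCl p) = 1 := by simpa using htr 1
  have hγ : z.γ = 1 := AlgEquiv.ext fun b => by simpa [hu] using htr b
  -- commuting with the dilation by 2
  have h2 : (2 : PadicAlgCl p) ≠ 0 := two_ne_zero
  have hdil := congrArg AffPi.t (hz (dil (Units.mk0 2 h2)))
  simp only [mul_t, dil_t, dil_u, dil_γ, Units.val_mk0, AlgEquiv.one_apply, mul_zero, add_zero,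
    zero_add, hγ] at hdil
  have ht : z.t = 0 := by linear_combination hdil
  rw [Subgroup.mem_bot]
  ext
  · simp [ht]
  · simp [hu]
  · simp [hγ]

/-! ## `ker ε` is the divisible part of `Π₀(k)` -/

/-- Powers of an element of `ker ε`: `⟨b, a, 1⟩ⁿ = ⟨b·(1 + a + ⋯ + aⁿ⁻¹), aⁿ, 1⟩`.
[cite: MochizukiAbsTopIII2015, Definition 3.1 (i) p.66] -/
theorem pow_of_γ_eq_one (x : AffPi k) (hx : x.γ = 1) (n : ℕ) :
    x ^ n = ⟨x.t * ∑ i ∈ Finset.range n, (x.u : PadicAlgCl p) ^ i, x.u ^ n, 1⟩ := by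
  induction n with
  | zero => ext <;> simp
  | succ n ih =>
    rw [pow_succ, ih]
    ext
    · simp only [mul_t, AlgEquiv.one_apply, Units.val_pow_eq_pow_val, Finset.sum_range_succ]
      ring
    · simp only [mul_u, Units.val_mul, Units.val_pow_eq_pow_val, coe_galUnits, AlgEquiv.one_apply,
        pow_succ]
    · simp [hx]

/-- Every element of `ker ε` has an `n`-th root in `Π₀(k)` for every `n ≥ 1` (`ℚ̄_p` is algebraically
closed of characteristic `0`: a translation `x ↦ x + b` is the `n`-th power of `x ↦ x + b/n`; for `a ≠ 1`
and `αⁿ = a`, `x ↦ a·x + b` is the `n`-th power of `x ↦ α·x + b(α-1)/(a-1)`).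
[cite: MochizukiAbsTopIII2015, Definition 3.1 (i) p.66] -/
theorem exists_pow_eq_of_γ_eq_one (x : AffPi k) (hx : x.γ = 1) (n : ℕ) (hn : 0 < n) :
    ∃ y : AffPi k, y ^ n = x := by
  by_cases ha : (x.u : PadicAlgCl p) = 1
  · -- translation: `n`-th root `x ↦ x + b/n`
    refine ⟨⟨x.t / n, 1, 1⟩, ?_⟩
    rw [pow_of_γ_eq_one _ rfl]
    have hn' : (n : PadicAlgCl p) ≠ 0 := Nat.cast_ne_zero.mpr hn.ne'
    ext
    · simp only [Units.val_one, one_pow, Finset.sum_const, Finset.card_range, nsmul_eq_mul, mul_one]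
      field_simp
    · simp only [one_pow, Units.val_one]
      exact ha.symm
    · simp [hx]
  · -- genuine dilation part: `αⁿ = a`, `α ≠ 1`
    obtain ⟨α, hα⟩ := IsAlgClosed.exists_pow_nat_eq (x.u : PadicAlgCl p) hn
    have hα0 : α ≠ 0 := by
      rintro rfl
      rw [zero_pow hn.ne'] at hα
      exact x.u.ne_zero hα.symm
    have hα1 : α ≠ 1 := by
      rintro rfl
      rw [one_pow] at hα
      exact ha hα.symm
    have hα1' : α - 1 ≠ 0 := sub_ne_zero.mpr hα1
    have ha1' : (x.u : PadicAlgCl p) - 1 ≠ 0 := sub_ne_zero.mpr ha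
    refine ⟨⟨x.t * (α - 1) / ((x.u : PadicAlgCl p) - 1), Units.mk0 α hα0, 1⟩, ?_⟩
    rw [pow_of_γ_eq_one _ rfl]
    have hgeom : (∑ i ∈ Finset.range n, α ^ i) * (α - 1) = (x.u : PadicAlgCl p) - 1 := by
      rw [geom_sum_mul, hα]
    ext
    · simp only [Units.val_mk0]
      have : (∑ i ∈ Finset.range n, α ^ i) = ((x.u : PadicAlgCl p) - 1) / (α - 1) := by
        rw [eq_div_iff hα1', hgeom]
      rw [this]
      field_simp
    · simp only [Units.val_pow_eq_pow_val, Units.val_mk0, hα]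
    · simp [hx]

/-- **`ker ε` = the divisible part of `Π₀(k)`**: `ε(x) = 1` iff `x` has an `n`-th root for every
`n ≥ 1` (⇒: roots in the affine group of the algebraically closed field `ℚ̄_p`; ⇐: `ε(x)` is then divisible
in the profinite group `G_k`, hence trivial).  Consequently `ker ε` is characteristic in `Π₀(k)`, even
for abstract automorphisms. [cite: MochizukiAbsTopIII2015, Definition 3.1 (i) p.66] -/
theorem γ_eq_one_iff_divisible (x : AffPi k) :
    x.γ = 1 ↔ ∀ n : ℕ, 0 < n → ∃ y : AffPi k, y ^ n = x := by
  refine ⟨fun hx n hn => exists_pow_eq_of_γ_eq_one x hx n hn, fun h => ?_⟩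
  refine algEquiv_eq_one_of_divisible k x.γ fun n hn => ?_
  obtain ⟨y, hy⟩ := h n hn
  exact ⟨y.γ, by rw [← hy]; exact (map_pow ε y n).symm⟩

/-! ## The translations are the commutator subgroup of `ker ε` -/

/-- **`T = ⁅ker ε, ker ε⁆`**: `ker ε = ℚ̄_p ⋊ ℚ̄_p^×` has abelian quotient `ℚ̄_p^×` by `T`, and every
translation is the commutator of the dilation by `2` with a translation (`char ℚ̄_p = 0`).
[cite: MochizukiAbsTopIII2015, Definition 3.1 (i) p.66] -/
theorem commutator_kerε : ⁅(ε (k := k)).ker, (ε (k := k)).ker⁆ = translations := by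
  apply le_antisymm
  · rw [Subgroup.commutator_le]
    intro x hx y hy
    rw [MonoidHom.mem_ker, ε_apply] at hx hy
    change x * y * x⁻¹ * y⁻¹ ∈ translations
    refine ⟨?_, by simp [hx, hy]⟩
    have hxu := x.u.ne_zero
    have hyu := y.u.ne_zero
    apply Units.ext
    simp only [mul_u, mul_γ, inv_u, inv_γ, hx, hy, inv_one, mul_one,
      Units.val_mul, Units.val_inv_eq_inv_val, coe_galUnits, AlgEquiv.one_apply, Units.val_one]
    field_simp
  · intro x hx
    rw [eq_tr_of_mem_translations hx]
    have h2 : (2 : PadicAlgCl p) ≠ 0 := two_ne_zero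
    have hd : (dil (Units.mk0 2 h2) : AffPi k) ∈ (ε (k := k)).ker := by
      rw [MonoidHom.mem_ker, ε_apply, dil_γ]
    have ht : (tr x.t : AffPi k) ∈ (ε (k := k)).ker := by
      rw [MonoidHom.mem_ker, ε_apply, tr_γ]
    -- the commutator of the dilation by `2` with `tr b` is `tr b`
    have hc : (dil (Units.mk0 2 h2) : AffPi k) * tr x.t * (dil (Units.mk0 2 h2))⁻¹ * (tr x.t)⁻¹
        = tr x.t := by
      rw [dil_mul_tr_mul_dil_inv, Units.val_mk0, tr_inv, tr_mul_tr]
      congr 1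
      ring
    have hmem := Subgroup.commutator_mem_commutator hd ht
    change _ * _ * _⁻¹ * _⁻¹ ∈ _ at hmem
    rwa [hc] at hmem

/-! ## Rigidity: every abstract group isomorphism `Π₀(k₁) ≃ Π₀(k₂)` is geometric -/

variable {k₁ k₂ : IntermediateField ℚ_[p] (PadicAlgCl p)}

/-- An abstract isomorphism `φ : Π₀(k₁) ≃ Π₀(k₂)` respects `ker ε` (the divisible parts).
[cite: MochizukiAbsTopIII2015, Proposition 3.2 (iv) p.72] -/
theorem γ_map_eq_one_iff (φ : AffPi k₁ ≃* AffPi k₂) (x : AffPi k₁) : (φ x).γ = 1 ↔ x.γ = 1 := by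
  rw [γ_eq_one_iff_divisible, γ_eq_one_iff_divisible]
  constructor
  · intro h n hn
    obtain ⟨y, hy⟩ := h n hn
    exact ⟨φ.symm y, by rw [← map_pow, hy, MulEquiv.symm_apply_apply]⟩
  · intro h n hn
    obtain ⟨y, hy⟩ := h n hn
    exact ⟨φ y, by rw [← map_pow, hy]⟩

/-- `φ(ker ε₁) = ker ε₂`. [cite: MochizukiAbsTopIII2015, Proposition 3.2 (iv) p.72] -/
theorem map_kerε (φ : AffPi k₁ ≃* AffPi k₂) :
    (ε (k := k₁)).ker.map φ.toMonoidHom = (ε (k := k₂)).ker := by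
  ext y
  constructor
  · rintro ⟨x, hx, rfl⟩
    rw [SetLike.mem_coe, MonoidHom.mem_ker, ε_apply] at hx
    rw [MonoidHom.mem_ker, ε_apply, MulEquiv.coe_toMonoidHom]
    exact (γ_map_eq_one_iff φ x).2 hx
  · intro hy
    refine ⟨φ.symm y, ?_, φ.apply_symm_apply y⟩
    rw [MonoidHom.mem_ker, ε_apply] at hy
    rw [SetLike.mem_coe, MonoidHom.mem_ker, ε_apply]
    have e := γ_map_eq_one_iff φ (φ.symm y)
    rw [φ.apply_symm_apply] at e
    exact e.1 hy

/-- `φ(T₁) = T₂`: an abstract isomorphism respects the translation subgroups (`T = ⁅ker ε, ker ε⁆`).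
[cite: MochizukiAbsTopIII2015, Proposition 3.2 (iv) p.72] -/
theorem map_translations (φ : AffPi k₁ ≃* AffPi k₂) :
    (translations (k := k₁)).map φ.toMonoidHom = translations := by
  rw [← commutator_kerε, Subgroup.map_commutator, map_kerε, commutator_kerε]

/-- `φ` maps translations to translations. [cite: MochizukiAbsTopIII2015, Proposition 3.2 (iv) p.72] -/
theorem map_mem_translations (φ : AffPi k₁ ≃* AffPi k₂) {x : AffPi k₁} (hx : x ∈ translations) :
    φ x ∈ translations := by
  rw [← map_translations φ]
  exact ⟨x, hx, rfl⟩

/-- `φ(tr b) = tr (A b)` with `A b :=` the translation part of `φ(tr b)`.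
[cite: MochizukiAbsTopIII2015, Proposition 3.2 (iv) p.72] -/
theorem map_tr (φ : AffPi k₁ ≃* AffPi k₂) (b : PadicAlgCl p) : φ (tr b) = tr (φ (tr b)).t :=
  eq_tr_of_mem_translations (map_mem_translations φ (tr_mem_translations b))

/-- `A` is additive. [cite: MochizukiAbsTopIII2015, Proposition 3.2 (iv) p.72] -/
theorem t_map_tr_add (φ : AffPi k₁ ≃* AffPi k₂) (b b' : PadicAlgCl p) :
    (φ (tr (b + b'))).t = (φ (tr b)).t + (φ (tr b')).t := by
  have h : φ (tr (b + b')) = tr ((φ (tr b)).t + (φ (tr b')).t) := by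
    rw [← tr_mul_tr, map_mul, map_tr φ b, map_tr φ b', tr_mul_tr, tr_t, tr_t]
  simpa using congrArg AffPi.t h

/-- `A` is injective. [cite: MochizukiAbsTopIII2015, Proposition 3.2 (iv) p.72] -/
theorem t_map_tr_injective (φ : AffPi k₁ ≃* AffPi k₂) :
    Function.Injective fun b : PadicAlgCl p => (φ (tr b)).t := fun b b' h => by
  have e : φ (tr b) = φ (tr b') := by rw [map_tr φ b, map_tr φ b']; exact congrArg tr h
  exact tr_injective (φ.injective e)

/-- `A` is surjective. [cite: MochizukiAbsTopIII2015, Proposition 3.2 (iv) p.72] -/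
theorem t_map_tr_surjective (φ : AffPi k₁ ≃* AffPi k₂) :
    Function.Surjective fun b : PadicAlgCl p => (φ (tr b)).t := fun c => by
  have hmem : φ.symm (tr c) ∈ translations := map_mem_translations φ.symm (tr_mem_translations c)
  refine ⟨(φ.symm (tr c)).t, ?_⟩
  change (φ (tr (φ.symm (tr c)).t)).t = c
  rw [← eq_tr_of_mem_translations hmem, MulEquiv.apply_symm_apply, tr_t]

/-- **The master identity** (conjugating a translation by `x` and applying `φ`):
`A(a·γ(b)) = a'·γ'(A b)` for `x = ⟨t, a, γ⟩`, `φ x = ⟨t', a', γ'⟩`.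
[cite: MochizukiAbsTopIII2015, Proposition 3.2 (iv) p.72] -/
theorem t_map_tr_conj (φ : AffPi k₁ ≃* AffPi k₂) (x : AffPi k₁) (b : PadicAlgCl p) :
    (φ (tr ((x.u : PadicAlgCl p) * x.γ b))).t = (φ x).u * (φ x).γ (φ (tr b)).t := by
  have h := congrArg φ (mul_tr_mul_inv x b)
  rw [map_mul, map_mul, map_inv, map_tr φ b, mul_tr_mul_inv, map_tr φ ((x.u : PadicAlgCl p) * x.γ b)]
    at h
  simpa using (congrArg AffPi.t h).symm

/-- The Galois part of `φ x` depends only on the Galois part of `x` (translations and dilations lie in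
`ker ε`, which `φ` respects). [cite: MochizukiAbsTopIII2015, Proposition 3.2 (iv) p.72] -/
theorem γ_map_eq_γ_map_lift (φ : AffPi k₁ ≃* AffPi k₂) (x : AffPi k₁) :
    (φ x).γ = (φ (lift x.γ)).γ := by
  have ht : (φ (tr x.t)).γ = 1 := (γ_map_eq_one_iff φ _).2 rfl
  have hd : (φ (dil x.u)).γ = 1 := (γ_map_eq_one_iff φ _).2 rfl
  conv_lhs => rw [eq_tr_mul_dil_mul_lift x]
  rw [map_mul, map_mul, mul_γ, mul_γ, ht, hd, one_mul, one_mul]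

/-- `A 1 ≠ 0` (`A` is injective with `A 0 = 0`). [cite: MochizukiAbsTopIII2015, Proposition 3.2 (iv) p.72] -/
theorem t_map_tr_one_ne_zero (φ : AffPi k₁ ≃* AffPi k₂) : (φ (tr 1)).t ≠ 0 := fun h => by
  have h0 : (φ (tr (0 : PadicAlgCl p))).t = 0 := by simp
  exact one_ne_zero (t_map_tr_injective φ (h.trans h0.symm))

/-- `A` is multiplicative up to the constant `A 1`: `A(a·b) = A(a)·A(1)⁻¹·A(b)` (the master identity at
the dilation by `a`). [cite: MochizukiAbsTopIII2015, Proposition 3.2 (iv) p.72] -/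
theorem t_map_tr_mul (φ : AffPi k₁ ≃* AffPi k₂) (a b : PadicAlgCl p) (ha : a ≠ 0) :
    (φ (tr (a * b))).t = (φ (tr a)).t * ((φ (tr 1)).t)⁻¹ * (φ (tr b)).t := by
  have hc := t_map_tr_one_ne_zero φ
  have hγ : (φ (dil (Units.mk0 a ha))).γ = 1 := (γ_map_eq_one_iff φ _).2 rfl
  have m1 := t_map_tr_conj φ (dil (Units.mk0 a ha)) b
  have m2 := t_map_tr_conj φ (dil (Units.mk0 a ha)) 1
  simp only [dil_u, dil_γ, Units.val_mk0, AlgEquiv.one_apply, hγ, mul_one] at m1 m2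
  rw [m1, m2]
  field_simp

/-- The Galois intertwining in `A`-coordinates: `A(γ b)/A(1) = γ'(A(b)/A(1))` where `γ'` is the Galois
part of `φ x`, `γ` that of `x` (the master identity at the Galois lift of `γ`, at `b` and at `1`).
[cite: MochizukiAbsTopIII2015, Proposition 3.2 (iv) p.72] -/
theorem t_map_tr_gal (φ : AffPi k₁ ≃* AffPi k₂) (x : AffPi k₁) (b : PadicAlgCl p) :
    (φ (tr (x.γ b))).t * ((φ (tr 1)).t)⁻¹ = (φ x).γ ((φ (tr b)).t * ((φ (tr 1)).t)⁻¹) := by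
  have hc := t_map_tr_one_ne_zero φ
  rw [γ_map_eq_γ_map_lift φ x]
  have m1 := t_map_tr_conj φ (lift x.γ) b
  have m2 := t_map_tr_conj φ (lift x.γ) 1
  simp only [lift_u, lift_γ, Units.val_one, one_mul, map_one] at m1 m2
  -- m1 : A (γ b) = a' * γ' (A b),  m2 : A 1 = a' * γ' (A 1)
  have hγc : (φ (lift x.γ)).γ (φ (tr 1)).t ≠ 0 := fun h => hc (by simpa using h)
  have ha' : ((φ (lift x.γ)).u : PadicAlgCl p) = (φ (tr 1)).t * ((φ (lift x.γ)).γ (φ (tr 1)).t)⁻¹ := by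
    rw [eq_mul_inv_iff_mul_eq₀ hγc]
    exact m2.symm
  rw [m1, map_mul, map_inv₀, ha']
  field_simp

/-- **Affine-group rigidity: every ABSTRACT group isomorphism `Π₀(k₁) ≃ Π₀(k₂)` is geometric.**  There is
a field automorphism `σ` of `ℚ̄_p` (namely `A/A(1)`, `A = φ|_T`; additive by construction, multiplicative by
the master identity at dilations) intertwining the Galois parts: `σ(γ b) = γ'(σ b)` whenever `φ` maps an
element with Galois part `γ` to one with Galois part `γ'` (master identity at Galois lifts).  This is the
content of the surjectivity half of Prop 3.2 (iv) for the witness objects.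
[cite: MochizukiAbsTopIII2015, Proposition 3.2 (iv) p.72] -/
theorem exists_ringEquiv_of_mulEquiv (φ : AffPi k₁ ≃* AffPi k₂) :
    ∃ σ : PadicAlgCl p ≃+* PadicAlgCl p,
      ∀ (x : AffPi k₁) (b : PadicAlgCl p), σ (x.γ b) = (φ x).γ (σ b) := by
  have hc := t_map_tr_one_ne_zero φ
  -- the ring endomorphism `σ₀ = A / A 1`
  let σ₀ : PadicAlgCl p →+* PadicAlgCl p :=
    { toFun := fun b => (φ (tr b)).t * ((φ (tr 1)).t)⁻¹
      map_one' := mul_inv_cancel₀ hc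
      map_mul' := fun a b => by
        by_cases ha : a = 0
        · simp [ha]
        · rw [t_map_tr_mul φ a b ha]
          ring
      map_zero' := by simp
      map_add' := fun b b' => by rw [t_map_tr_add]; ring }
  have hσ₀ : ∀ b, σ₀ b = (φ (tr b)).t * ((φ (tr 1)).t)⁻¹ := fun _ => rfl
  have hsurj : Function.Surjective σ₀ := fun y => by
    obtain ⟨b, hb⟩ := t_map_tr_surjective φ (y * (φ (tr 1)).t)
    refine ⟨b, ?_⟩
    change (φ (tr b)).t = y * (φ (tr 1)).t at hb
    rw [hσ₀, hb, mul_assoc, mul_inv_cancel₀ hc, mul_one]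
  refine ⟨RingEquiv.ofBijective σ₀ ⟨σ₀.injective, hsurj⟩, fun x b => ?_⟩
  rw [RingEquiv.ofBijective_apply, RingEquiv.ofBijective_apply, hσ₀, hσ₀]
  exact t_map_tr_gal φ x b

end AffPi

end TFModel

end Literature.AnabelianGeometry.AbsoluteAnabelian.AbsTopIII

end
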